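import Summits.MatrixMultiplication.MatrixMultiplication.Theorems.AbelianSTPPCensusTAStatKMemberX2

/-!
# Static t*-certificate under a GENERAL Grynkiewicz budget constant (the quartet's U11-G′ floor): node tests and one-member cover, data-free

Cell mm-stpp (rung F-M1), seat mm-stpp-vp-p2 (gen 8); census-silent KERNEL ENABLER for the tranche-2 device bands (HOME/STATUS plan g20
2026-08-28T22:53:43Z: «the tree machine re-issued under U11-G′, consuming theory's `U11GPrimeTools.gw_budget_A/B/C` and `Quartet.QuartetAdm` by name»).
The static t*-indexed certificate (`AbelianSTPPCensusTAStatDefs.lean`, theory g11) and its k-member bucket-descent tree (`…TAStatKMember*.lean`, vp-p2 g5–g7) hard-wire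
the trio's rule U11-G through ONE inequality, the Grynkiewicz budget of a source member at a parameter `t ≥ 3`:
`Σ_{q} (t·p_q − V_q) ≤ t·M + (2t² − 1)` (`TAStat.budget_form'`).  After PRE-REG v1 band B3 the census owns rule U11-G′ (`U11GPrime`, theory g13;
Grynkiewicz–Wang 2026 floor), whose budget form is the same inequality with the constant `⌊(4t² − 2t)/3⌋` and the guard `t ≥ 2`
(`U11GPrimeTools.budget_formGW`, `gw_budget_A/B/C`).  This file re-issues the budget-dependent Bool checks of the machine with the constant as a PARAMETER
`bud : ℕ → ℕ` and the guard as a parameter `t0` (so that `bud t = 2t² − 1, t0 = 3` is the trio machine and `bud = gwC, t0 = 2` the quartet machine):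
* `vpIQ`, `vpCandQ`, `vpThreshQ`, `coverQ` — the one-member cover (`TAStat.vpI/vpCand/vpThresh/cover`; the vM pieces `TAStat.piece/pcs` are reused by name);
* `c2WQ` — the U11-type test with explicit companions (`TAStat2M.c2W`); `testKQ`, `testXQ`, `testKXQ` — the node tests of the k-member tree
  (`TAStatKM.testK/testX/testKX`; the cap tests `TAStat2M.c2A/c2B/c2E` and the aggregates `TAStatKM.Agg/agg0/addM` are reused by name);
* `vpQ_mono`, `vpThreshQ_le`, `testKQ_sound`, `testXQ_sound` — their arithmetic meaning, verbatim the trio proofs with `bud t` for `2t² − 1`.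
The tree / root / order cover / bucket walk over these tests, their soundness and the kernel-layout lemmas are `AbelianSTPPCensusTAStatQ{Tree,Sound,Split}.lean`;
the instantiation `bud = gwC` from `SieveAdmissible ∧ U11GPrime` is `AbelianSTPPCensusTAStatQBudget.lean`.  Existing files are untouched.
WHAT THIS IS NOT: no data table, no order range, no certificate is run; no statement about STPP families, no census number, no existence claim, no `ω`.
-/

set_option linter.dupNamespace false
set_option autoImplicit false

namespace Summit.MatrixMultiplication.MatrixMultiplication.Theorems.TAStatQ

open TECert (vol us)
open TAStat (Entry e0 piece pcs)
open TAStat2M (c2A c2B c2E)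
open TAStatKM (Agg agg0 addM)
open ShapeCert (D)

/-- **The Grynkiewicz–Wang constant** `⌊(4t² − 2t)/3⌋` of rule U11-G′ (`U11GPrimeFormB`; `U11GPrimeTools.budget_formGW`). [bookkeeping] -/
def gwC (t : ℕ) : ℕ := (4 * t * t - 2 * t) / 3

/-- `gwC 20 = 520` (the T_D wall order `668` is read at `t′ = 20`); `2·20² − 1 = 799`. [bookkeeping] -/
theorem gwC_twenty : gwC 20 = 520 := by decide

/-- The Grynkiewicz–Wang constant is at most the trio's `2t² − 1` for `t ≥ 1` (so every check of this file with `bud = gwC` is at least as strong as the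
trio's at the same parameter). [bookkeeping] -/
theorem gwC_le (t : ℕ) (ht : 1 ≤ t) : gwC t ≤ 2 * t * t - 1 := by
  unfold gwC
  have h1 : (4 * t * t - 2 * t) / 3 ≤ (4 * t * t) / 3 := Nat.div_le_div_right (Nat.sub_le _ _)
  have h2 : (4 * t * t) / 3 < 2 * t * t := by
    rw [Nat.div_lt_iff_lt_mul (by norm_num)]
    have : 1 ≤ t * t := Nat.mul_pos ht ht
    nlinarith
  omega

section Checks

variable (bud : ℕ → ℕ) (t0 : ℕ)

/-! ## The one-member cover with budget constant `bud t` -/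

/-- U11-type bound at order `M` for a maximal member (gain `g`, pair-product sum `p`, volume `V`) at budget parameter `t`:
`t·gW·M + (g·wW + bud(t)·gW) ≤ 10⁶·wW·M + (t·p − V)·gW` (`TAStat.vpI` with `bud t` for `2t² − 1`). [original] -/
def vpIQ (g p V t M : ℕ) (e : Entry) : Bool :=
  Nat.ble (t * e.2.2.1 * M + (g * e.2.2.2 + bud t * e.2.2.1)) (D * e.2.2.2 * M + (t * p - V) * e.2.2.1)

/-- Candidate threshold (a division estimate; only its verification matters), as `TAStat.vpCand`. [original] -/
def vpCandQ (g p V t L H : ℕ) (e : Entry) : ℕ :=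
  max L (max ((t * p - V + t - 1) / t)
    (if g * e.2.2.2 + bud t * e.2.2.1 ≤ (t * p - V) * e.2.2.1 then 0
     else if D * e.2.2.2 - t * e.2.2.1 = 0 then H + 1
     else (g * e.2.2.2 + bud t * e.2.2.1 - (t * p - V) * e.2.2.1 + (D * e.2.2.2 - t * e.2.2.1) - 1) / (D * e.2.2.2 - t * e.2.2.1)))

/-- The verified threshold: an order `M₁ ∈ [L, H]` with `t0 ≤ t`, `V < t·p`, slope `t·gW ≤ 10⁶·wW`, `vpIQ` at `M₁` and `t·p − V ≤ t·M₁` (the bound then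
holds at every order `≥ M₁`, `vpQ_mono`), or `H + 1`.  As `TAStat.vpThresh` with guard `t0` for `3`. [original] -/
def vpThreshQ (g p V t L H : ℕ) (e : Entry) : ℕ :=
  let c := vpCandQ bud g p V t L H e
  if t0 ≤ t ∧ V < t * p ∧ t * e.2.2.1 ≤ D * e.2.2.2 ∧ c ≤ H ∧ vpIQ bud g p V t c e = true ∧ t * p - V ≤ t * c then c else H + 1

/-- The one-member check of a maximal member (gain `g`, pair-product sum `p`, volume `V`, excess `d`) at budget parameter `t` for the orders `[L, H]`:
the U11-type bound from the threshold on, vM (one piece, else `TAStat.J` pieces — `TAStat.piece/pcs` by name) below it.  As `TAStat.cover`. [original] -/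
def coverQ (g p V d t L H : ℕ) (e : Entry) : Bool :=
  let M1 := vpThreshQ bud t0 g p V t L H e
  Nat.ble M1 L || (piece g V d e L (min H (M1 - 1)) || pcs g V d e TAStat.J L (min H (M1 - 1)))

/-! ## The node tests with budget constant `bud t` -/

/-- U11-type test at order `M` with explicit companions (total gain `gm`, pair-product sum `pm`, volume `Vm`):
`(g+g_m)·wW + gW·(t·M + bud t) ≤ 10⁶·M·wW + gW·((t·p − V) + (t·p_m − V_m))` (`TAStat2M.c2W` with `bud t` for `2t² − 1`). [original] -/
def c2WQ (g p V t gm pm Vm M : ℕ) (e : Entry) : Bool :=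
  Nat.ble ((g + gm) * e.2.2.2 + e.2.2.1 * (t * M + bud t)) (D * M * e.2.2.2 + e.2.2.1 * ((t * p - V) + (t * pm - Vm)))

/-- **Node test** (`TAStatKM.testK` with guard `t0 ≤ t` and constant `bud t`): at order `M` for the maximal member `l` = (gain `g`, pair-product sum `p`, volume
`V`, excess `d`, smallest size `al`, least pair product `tl`) with explicit-companion aggregates `A`, at a bucket with lower end `tbj`, budget parameter `t`,
density entry `e`; `root` allows the implicit budget source.  U11-type branch (guards: `t0 ≤ t`, `V < t·p`, `amax ≤ t`, a source; then «budget exceeded» or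
`c2WQ`), U11 cap, U14 cap at `l`, E3 cap at `l` (each with its «cap exceeded» escape; `TAStat2M.c2A/c2B/c2E` by name). [original] -/
def testKQ (g p V d al tl : ℕ) (A : Agg) (tbj t M : ℕ) (e : Entry) (root : Bool) : Bool :=
  (Nat.ble t0 t && Nat.blt V (t * p) && Nat.ble A.2.2.2.2.1 t &&
      (root || Nat.blt A.2.2.2.1 t || (Nat.ble tbj tl && Nat.blt al t)) &&
      (Nat.blt (t * M + bud t) ((t * p - V) + (t * A.2.1 - A.2.2.1)) || c2WQ bud g p V t A.1 A.2.1 A.2.2.1 M e)) ||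
  Nat.blt (3 * M) (d + 2 * A.2.1) || c2A g d A.1 A.2.1 M e ||
  Nat.blt (3 * M) (3 * V + A.2.1) || c2B g V A.1 A.2.1 M e ||
  (Nat.blt M (2 * V) && Nat.blt (V * V / M + 3 * M) (4 * V + A.2.1)) || c2E g V A.1 A.2.1 M e

/-- **Extra U11-type test** at a parameter `x.1 = t′` with density `x.2 = (gW′, wW′)` and an EXPLICIT source only (`TAStatKM.testX` with guard `t0 ≤ t′` and
constant `bud t′`). [original] -/
def testXQ (g p V al tl : ℕ) (A : Agg) (tbj M : ℕ) (x : ℕ × ℕ × ℕ) : Bool :=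
  Nat.ble t0 x.1 && Nat.blt V (x.1 * p) && Nat.ble A.2.2.2.2.1 x.1 &&
    ((Nat.blt A.2.2.2.1 x.1 && Nat.ble x.1 tbj) || (Nat.blt al x.1 && Nat.ble x.1 tl)) &&
    (Nat.blt (x.1 * M + bud x.1) ((x.1 * p - V) + (x.1 * A.2.1 - A.2.2.1)) ||
      c2WQ bud g p V x.1 A.1 A.2.1 A.2.2.1 M (0, 1, x.2.1, x.2.2))

/-- the node test with extras: `testKQ` at the bucket parameter, or some extra entry of the bucket passes `testXQ` (`TAStatKM.testKX`) [original] -/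
def testKXQ (g p V d al tl : ℕ) (A : Agg) (tbj t M : ℕ) (e : Entry) (root : Bool) (xs : List (ℕ × ℕ × ℕ)) : Bool :=
  testKQ bud t0 g p V d al tl A tbj t M e root || xs.any (testXQ bud t0 g p V al tl A tbj M)

/-! ## Arithmetic meaning -/

variable {bud t0}

/-- monotonicity of the U11-type bound in the order: with slope `t·gW ≤ 10⁶·wW`, `vpIQ` at `M₁` gives `vpIQ` at every `M ≥ M₁` (as `TAStat.vp_mono`). [bookkeeping] -/
theorem vpQ_mono {g p V t M₁ M : ℕ} {e : Entry} (hslope : t * e.2.2.1 ≤ D * e.2.2.2) (h1 : M₁ ≤ M)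
    (hA : vpIQ bud g p V t M₁ e = true) : vpIQ bud g p V t M e = true := by
  simp only [vpIQ, Nat.ble_eq] at hA ⊢
  obtain ⟨k, rfl⟩ := Nat.exists_eq_add_of_le h1
  have hk : t * e.2.2.1 * k ≤ D * e.2.2.2 * k := Nat.mul_le_mul_right _ hslope
  have e1 : t * e.2.2.1 * (M₁ + k) = t * e.2.2.1 * M₁ + t * e.2.2.1 * k := by ring
  have e2 : D * e.2.2.2 * (M₁ + k) = D * e.2.2.2 * M₁ + D * e.2.2.2 * k := by ring
  rw [e1, e2]; omega

/-- what a verified threshold certifies (as `TAStat.vpThresh_le`) [bookkeeping] -/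
theorem vpThreshQ_le {g p V t L H : ℕ} {e : Entry} (h : vpThreshQ bud t0 g p V t L H e ≤ H) :
    t0 ≤ t ∧ V < t * p ∧ t * e.2.2.1 ≤ D * e.2.2.2 ∧ vpIQ bud g p V t (vpThreshQ bud t0 g p V t L H e) e = true ∧
      t * p - V ≤ t * vpThreshQ bud t0 g p V t L H e := by
  unfold vpThreshQ at h ⊢
  simp only at h ⊢
  split_ifs at h ⊢ with hc
  · exact ⟨hc.1, hc.2.1, hc.2.2.1, hc.2.2.2.2.1, hc.2.2.2.2.2⟩
  · omega

/-- a passing cover gives either the verified threshold at or below `M` or a vM piece around `M` (the two cases a range's main estimate treats; as for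
`TAStat.cover`) [bookkeeping] -/
theorem coverQ_cases {g p V d t L H M : ℕ} {e : Entry} (h : coverQ bud t0 g p V d t L H e = true) (hLM : L ≤ M) :
    vpThreshQ bud t0 g p V t L H e ≤ M ∨
      (M < vpThreshQ bud t0 g p V t L H e ∧
        (piece g V d e L (min H (vpThreshQ bud t0 g p V t L H e - 1)) = true ∨
          pcs g V d e TAStat.J L (min H (vpThreshQ bud t0 g p V t L H e - 1)) = true)) := by
  simp only [coverQ, Bool.or_eq_true, Nat.ble_eq] at h
  by_cases hVP : vpThreshQ bud t0 g p V t L H e ≤ M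
  · exact Or.inl hVP
  · push Not at hVP
    rcases h with hle | hpc
    · exfalso; omega
    · exact Or.inr ⟨hVP, hpc⟩

/-- **Soundness of the node test.**  At order `M`, with `GR`, `R`, `W` the non-explicit members' total gain, pair-product sum and U11-type weight at `t`:
the density bounds `GR·pP ≤ gP·R`, `GR·wW ≤ gW·W`, the caps `2(pO + R) + d ≤ 3M`, `pO + R + 3V ≤ 3M`, `M < 2V → pO + R ≤ (⌊V²/M⌋ + 3M) − 4V`,
some companion at all (`1 ≤ pO + R`) and — under the test's guards — the budget `(t·p − V) + (t·pO − vO) + W ≤ t·M + bud t` give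
`g + gO + GR ≤ 10⁶·M`.  (Verbatim `TAStatKM.testK_sound` with `bud t` for `2t² − 1` and `t0` for `3`.) [original] -/
theorem testKQ_sound {g p V d al tl : ℕ} {A : Agg} {tbj t M : ℕ} {e : Entry} {root : Bool}
    (h : testKQ bud t0 g p V d al tl A tbj t M e root = true)
    {GR R W : ℕ} (hpP : 1 ≤ e.2.1) (hwW : 1 ≤ e.2.2.2) (hpos : 1 ≤ A.2.1 + R)
    (hGP : GR * e.2.1 ≤ e.1 * R) (hGW : GR * e.2.2.2 ≤ e.2.2.1 * W)
    (hA : 2 * (A.2.1 + R) + d ≤ 3 * M) (hB : A.2.1 + R + 3 * V ≤ 3 * M)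
    (hE : M < 2 * V → A.2.1 + R ≤ (V * V / M + 3 * M) - 4 * V)
    (hW : t0 ≤ t → V < t * p → A.2.2.2.2.1 ≤ t → (root = true ∨ A.2.2.2.1 < t ∨ (tbj ≤ tl ∧ al < t)) →
      (t * p - V) + (t * A.2.1 - A.2.2.1) + W ≤ t * M + bud t) :
    g + A.1 + GR ≤ D * M := by
  simp only [testKQ, Bool.or_eq_true, Bool.and_eq_true, Nat.ble_eq, Nat.blt_eq] at h
  rcases h with (((((hw | hi1) | ha) | hi2) | hb) | hie) | hee
  · obtain ⟨⟨⟨⟨ht3, hVtp⟩, hamax⟩, hsrc⟩, hbw⟩ := hw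
    have hsrc' : root = true ∨ A.2.2.2.1 < t ∨ (tbj ≤ tl ∧ al < t) := by
      rcases hsrc with (hr | hm) | hl
      · exact Or.inl hr
      · exact Or.inr (Or.inl hm)
      · exact Or.inr (Or.inr hl)
    have hW' := hW ht3 hVtp hamax hsrc'
    rcases hbw with hover | hc
    · exfalso; omega
    · simp only [c2WQ, Nat.ble_eq] at hc
      have h1 : e.2.2.1 * ((t * p - V) + (t * A.2.1 - A.2.2.1)) + e.2.2.1 * W ≤ e.2.2.1 * (t * M + bud t) := by
        rw [← Nat.mul_add]; exact Nat.mul_le_mul_left _ hW'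
      have key : (g + A.1 + GR) * e.2.2.2 ≤ D * M * e.2.2.2 := by
        rw [Nat.add_mul]
        omega
      exact Nat.le_of_mul_le_mul_right key hwW
  · exfalso; omega
  · simp only [c2A, Nat.ble_eq] at ha
    have h1 : e.1 * (d + 2 * A.2.1) + e.1 * (2 * R) ≤ e.1 * (3 * M) := by
      rw [← Nat.mul_add]; exact Nat.mul_le_mul_left _ (by omega)
    have h2 : 2 * (GR * e.2.1) ≤ e.1 * (2 * R) := by
      calc 2 * (GR * e.2.1) ≤ 2 * (e.1 * R) := Nat.mul_le_mul_left _ hGP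
        _ = e.1 * (2 * R) := by ring
    have key : (g + A.1 + GR) * e.2.1 ≤ D * M * e.2.1 := by
      have e1 : 2 * (g + A.1) * e.2.1 = 2 * ((g + A.1) * e.2.1) := by ring
      have e2 : 2 * D * M * e.2.1 = 2 * (D * M * e.2.1) := by ring
      rw [e1, e2] at ha
      rw [Nat.add_mul]
      omega
    exact Nat.le_of_mul_le_mul_right key hpP
  · exfalso; omega
  · simp only [c2B, Nat.ble_eq] at hb
    have h1 : e.1 * (3 * V + A.2.1) + e.1 * R ≤ e.1 * (3 * M) := by
      rw [← Nat.mul_add]; exact Nat.mul_le_mul_left _ (by omega)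
    have key : (g + A.1 + GR) * e.2.1 ≤ D * M * e.2.1 := by
      rw [Nat.add_mul]
      omega
    exact Nat.le_of_mul_le_mul_right key hpP
  · exfalso
    obtain ⟨h2V, hlt⟩ := hie
    have hcap := hE h2V
    generalize V * V / M + 3 * M = C at hlt hcap
    omega
  · simp only [c2E, Bool.and_eq_true, Nat.blt_eq, Nat.ble_eq] at hee
    obtain ⟨h2V, he⟩ := hee
    have hcap := hE h2V
    generalize hC : V * V / M + 3 * M = C at he hcap
    have hC4 : 4 * V + A.2.1 + R ≤ C := by omega
    have h1 : e.1 * (4 * V + A.2.1) + e.1 * R ≤ e.1 * C := by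
      rw [← Nat.mul_add]; exact Nat.mul_le_mul_left _ hC4
    have key : (g + A.1 + GR) * e.2.1 ≤ D * M * e.2.1 := by
      rw [Nat.add_mul]
      omega
    exact Nat.le_of_mul_le_mul_right key hpP

/-- **Soundness of the extra test.**  At order `M`, with `GR`, `W` the non-explicit members' total gain and U11-type weight at `t′ = x.1`: the density bound
`GR·wW′ ≤ gW′·W` and — under the test's guards — the budget `(t′·p − V) + (t′·pO − vO) + W ≤ t′·M + bud t′` give `g + gO + GR ≤ 10⁶·M`.
(Verbatim `TAStatKM.testX_sound`.) [original] -/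
theorem testXQ_sound {g p V al tl : ℕ} {A : Agg} {tbj M : ℕ} {x : ℕ × ℕ × ℕ}
    (h : testXQ bud t0 g p V al tl A tbj M x = true)
    {GR W : ℕ} (hwW : 1 ≤ x.2.2) (hGW : GR * x.2.2 ≤ x.2.1 * W)
    (hW : t0 ≤ x.1 → V < x.1 * p → A.2.2.2.2.1 ≤ x.1 → ((A.2.2.2.1 < x.1 ∧ x.1 ≤ tbj) ∨ (al < x.1 ∧ x.1 ≤ tl)) →
      (x.1 * p - V) + (x.1 * A.2.1 - A.2.2.1) + W ≤ x.1 * M + bud x.1) :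
    g + A.1 + GR ≤ D * M := by
  simp only [testXQ, Bool.or_eq_true, Bool.and_eq_true, Nat.ble_eq, Nat.blt_eq] at h
  obtain ⟨⟨⟨⟨ht3, hVtp⟩, hamax⟩, hsrc⟩, hbw⟩ := h
  have hW' := hW ht3 hVtp hamax hsrc
  rcases hbw with hover | hc
  · exfalso; omega
  · simp only [c2WQ, Nat.ble_eq] at hc
    have h1 : x.2.1 * ((x.1 * p - V) + (x.1 * A.2.1 - A.2.2.1)) + x.2.1 * W ≤ x.2.1 * (x.1 * M + bud x.1) := by
      rw [← Nat.mul_add]; exact Nat.mul_le_mul_left _ hW'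
    have key : (g + A.1 + GR) * x.2.2 ≤ D * M * x.2.2 := by
      rw [Nat.add_mul]
      omega
    exact Nat.le_of_mul_le_mul_right key hwW

/-- a passing node test with extras passes the bucket test or some extra test (unfolding) [bookkeeping] -/
theorem testKXQ_cases {g p V d al tl : ℕ} {A : Agg} {tbj t M : ℕ} {e : Entry} {root : Bool} {xs : List (ℕ × ℕ × ℕ)}
    (h : testKXQ bud t0 g p V d al tl A tbj t M e root xs = true) :
    testKQ bud t0 g p V d al tl A tbj t M e root = true ∨ ∃ x ∈ xs, testXQ bud t0 g p V al tl A tbj M x = true := by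
  rw [testKXQ, Bool.or_eq_true, List.any_eq_true] at h
  exact h

end Checks

end Summit.MatrixMultiplication.MatrixMultiplication.Theorems.TAStatQ
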